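import Mathlib
import HarnessLib
import Summits.NavierStokesRegularity.NavierStokesRegularity.Theorems.PoloidalWindowDoorLrcModEntireQ4WebPackage
import Summits.NavierStokesRegularity.NavierStokesRegularity.Theorems.PoloidalWindowDoorLrcModEntireSheetTransport
import Summits.NavierStokesRegularity.NavierStokesRegularity.Theorems.PoloidalWindowDoorPoloidalWindowRigidityVerticalShearGerm

/-!
# Route `PoloidalWindowDoor`, item `LrcModEntire` (stmt-NavierStokesRegularity-20428) — CELL (Q4-SONIC), SUB-CELL «STRAIGHT BRANCH, μ(−1,0) = 0» CLOSED

Cell ns-regularity-ideate, LEAD-lineage seat ns-poloidal-K2-p3 g16 (`--supports stmt-NavierStokesRegularity-20428`; memo `Cruxes/LrcModEntire/T2B-g16.md` §5;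
PICKED.md v10 «disprover-wanted: stub_Q4sonic»).  In the SONIC cell (`R(0,·)` affine on `(−δ,δ)`) over a straight branch the parallel-web package
(`…Q4WebPackage.line_web_package`) still applies; Huygens' identity with `R″ = 0` makes the sheet CHARACTERISTIC, `d′(z)² + μ(−1,z) = 0` on the window, and the
transport law (`…SheetTransport.transport_on_characteristic_sheet`) makes `d′·(∂_ν²U₂)²` constant along the web.  If `μ(−1,0) = 0` then `d′(0) = 0`, so the
constant is `0`; strict concavity forces `d′ ≡ 0`, hence `μ(−1,·) ≡ 0` on the window, i.e. the horizontal velocity has NO vertical shear on an open slab of the slice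
`t = −1` — and `…VerticalShearGerm.eq_zero_of_verticalShear_eq_zero_on_open` empties the profile (`U ≡ 0`, contradicting `U₂(−1,0) ≠ 0`).

* `q4sonic_line_flat_core` — hypotheses = those of `line_web_package` + «sonic» + `μ(−1,0) = 0` ⊢ `False`.

The residual (Q4-sonic) research cells are «straight branch, μ(−1,0) < 0» and «curved branch».
WHAT THIS IS NOT: not a claim about Navier–Stokes regularity — a sub-cell of one research cell of the (TH) column closes; items 20428 / 19708 / 27893 OPEN.
-/

noncomputable section

set_option linter.dupNamespace false
set_option linter.unusedVariables false

namespace Summit.NavierStokesRegularity.NavierStokesRegularity.Theorems.PoloidalWindowDoorLrcModEntireQ4SonicLineFlat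

open Set Function Filter Topology Metric
open scoped RealInnerProductSpace InnerProductSpace Laplacian ContDiff
open Literature.Analysis Literature.Analysis.FluidPDE Literature.Analysis.UnboundedOperators
open Summit.NavierStokesRegularity.NavierStokesRegularity.Theorems.PoloidalWindowDoorLrcModEntireSheetCauchyUniqueness
open Summit.NavierStokesRegularity.NavierStokesRegularity.Theorems.PoloidalWindowDoorLrcModEntireSheetFlattenTools
open Summit.NavierStokesRegularity.NavierStokesRegularity.Theorems.PoloidalWindowDoorLrcModEntireSheetTransport
open Summit.NavierStokesRegularity.NavierStokesRegularity.Theorems.PoloidalWindowDoorLrcModEntireQ4WebPackage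
open Summit.NavierStokesRegularity.NavierStokesRegularity.Theorems.PoloidalWindowDoorPoloidalWindowRigidityTimeHeightShearLinearSlice
open Summit.NavierStokesRegularity.NavierStokesRegularity.Theorems.PoloidalWindowDoorPoloidalWindowRigidityConstantShearSlice
open Summit.NavierStokesRegularity.NavierStokesRegularity.Theorems.PoloidalWindowDoorPoloidalWindowRigidityVerticalShearGerm
open Summit.NavierStokesRegularity.NavierStokesRegularity.Theorems.LocalSineTubeDoorProfileAlignedWindowRigidityAncient

/-- **CELL (Q4-SONIC), SUB-CELL «STRAIGHT BRANCH, μ(−1,0) = 0» IS EMPTY — core form.**  Hypotheses = the conjuncts of the (Q4) package used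
(`F = fun τ y => σ·U₂(−1+τ,y)` substituted), the line literal, the sonic literal (`R(0,·)` affine on `(−δ,δ)`), and `μ(−1,0) = 0`. -/
theorem q4sonic_line_flat_core {C : ℝ} {U : ℝ → EuclideanSpace ℝ (Fin 3) → EuclideanSpace ℝ (Fin 3)} {Γ νΓ : ℝ → EuclideanSpace ℝ (Fin 3)}
    {R μ : ℝ → ℝ → ℝ} {σ κ r δ ρ : ℝ}
    (hUrate : HasTypeITimeDecay C U) (hUcont : ContinuousOn (uncurry U) (Iio (0 : ℝ) ×ˢ univ))
    (hUmild : ∀ s t : ℝ, s < t → t < 0 → ∀ x, U t x = heatExtension (U s) (t - s) x - oseenDuhamel 1 s U U t x)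
    (hUdiv : ∀ t < 0, VectorCalculus.IsDivFree (U t))
    (hUpol : ∀ s < 0, ∀ q, ⟪curl (U s) q, EuclideanSpace.single 2 1⟫_ℝ = 0)
    (hUne : U (-1) 0 2 ≠ 0) (hUhotbd : ∀ t < 0, ∀ x, Real.sqrt (-t) * |U t x 2| ≤ |U (-1) 0 2|)
    (hσ : σ = 1 ∨ σ = -1) (hσN : σ * U (-1) 0 2 = |U (-1) 0 2|) (hκ : 0 < κ)
    (hΓ0 : Γ 0 = 0) (hΓ2 : ∀ s, Γ s 2 = 0) (hΓunit : ∀ s, ‖deriv Γ s‖ = 1) (hΓhot : ∀ s, U (-1) (Γ s) 2 = U (-1) 0 2)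
    (hν : ∀ s, νΓ s = WithLp.toLp 2 ![-(deriv Γ s 1), deriv Γ s 0, 0])
    (hΓcurv : ∀ s, κ ≤ -(fderiv ℝ (fderiv ℝ (fun y => σ * U (-1) y 2)) (Γ s) (νΓ s) (νΓ s)))
    (hr : 0 < r) (hδ : 0 < δ)
    (hconc : ∀ τ z : ℝ, |τ| < δ → |z| < δ → ∀ s : ℝ, ∀ n ∈ Ioo (-r) r,
      fderiv ℝ (fderiv ℝ (fun y => σ * U (-1 + τ) y 2)) (Γ s + n • νΓ s + z • EuclideanSpace.single 2 (1 : ℝ)) (νΓ s) (νΓ s) < 0)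
    (hweb : ∀ τ₀ z₀ : ℝ, |τ₀| < δ → |z₀| < δ → ∀ s₀ : ℝ, ∃ n₀ ∈ Ioo (-r) r,
      σ * U (-1 + τ₀) (Γ s₀ + n₀ • νΓ s₀ + z₀ • EuclideanSpace.single 2 (1 : ℝ)) 2 = R τ₀ z₀ ∧
      (∀ n ∈ Icc (-r) r, n ≠ n₀ → σ * U (-1 + τ₀) (Γ s₀ + n • νΓ s₀ + z₀ • EuclideanSpace.single 2 (1 : ℝ)) 2 < R τ₀ z₀) ∧
      DifferentiableAt ℝ (uncurry R) (τ₀, z₀) ∧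
      fderiv ℝ (uncurry fun τ y => σ * U (-1 + τ) y 2) (τ₀, Γ s₀ + n₀ • νΓ s₀ + z₀ • EuclideanSpace.single 2 (1 : ℝ)) =
        (fderiv ℝ (uncurry R) (τ₀, z₀)).comp
          ((ContinuousLinearMap.fst ℝ ℝ (EuclideanSpace ℝ (Fin 3))).prod
            ((EuclideanSpace.proj (2 : Fin 3)).comp (ContinuousLinearMap.snd ℝ ℝ (EuclideanSpace ℝ (Fin 3))))))
    (hρ : 0 < ρ) (hμ3 : ContDiff ℝ 3 (uncurry μ))
    (hslabU : ∀ t : ℝ, |t + 1| < ρ → ∀ x : EuclideanSpace ℝ (Fin 3), |x 2| < ρ → ∀ b : Fin 3, b ≠ 2 →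
      fderiv ℝ (U t) x (EuclideanSpace.single 2 1) b = μ t (x 2) * fderiv ℝ (U t) x (EuclideanSpace.single b 1) 2)
    (hevU : ∀ t₀ : ℝ, |t₀ + 1| < ρ → ∀ y₀ : EuclideanSpace ℝ (Fin 3), y₀ 2 = 0 →
      ∀ᶠ z in 𝓝 ((t₀, y₀) : ℝ × EuclideanSpace ℝ (Fin 3)), ∀ b : Fin 3, b ≠ 2 →
        fderiv ℝ (U z.1) z.2 (EuclideanSpace.single 2 1) b = μ z.1 (z.2 2) * fderiv ℝ (U z.1) z.2 (EuclideanSpace.single b 1) 2)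
    (hline : ∀ s : ℝ, Γ s = s • deriv Γ 0) (hson : ∃ a b : ℝ, ∀ z : ℝ, |z| < δ → R 0 z = a + b * z)
    (hμ00 : μ (-1) 0 = 0) : False := by
  obtain ⟨δ₁, d, κf, hδ₁, hδ₁δ, hδ₁ρ, he2, hunit, hdω, hRω, hκf, hHuy, hcrit, hconcW⟩ :=
    line_web_package hUrate hUcont hUmild hUdiv hUpol hUne hUhotbd hσ hσN hκ hΓ0 hΓ2 hΓunit hΓhot hν hΓcurv hr hδ hconc hweb hρ hμ3
      hslabU hevU hline
  set e : EuclideanSpace ℝ (Fin 3) := deriv Γ 0 with he_def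
  have hm1 : (-1 : ℝ) < 0 := by norm_num
  have hwin : ∀ z ∈ Ioo (-δ₁) δ₁, |z| < δ ∧ |z| < ρ := fun z hz =>
    ⟨lt_of_lt_of_le (abs_lt.2 hz) hδ₁δ, lt_of_lt_of_le (abs_lt.2 hz) hδ₁ρ⟩
  have h0mem : (0 : ℝ) ∈ Ioo (-δ₁) δ₁ := ⟨by linarith, hδ₁⟩
  /- STEP 1: sonic ⇒ `R″(0,·) = 0` on the window ⇒ the sheet is characteristic, `d′² + μ ≡ 0`. -/
  obtain ⟨a, b, hab⟩ := hson
  have hR'' : ∀ z ∈ Ioo (-δ₁) δ₁, deriv (deriv (R 0)) z = 0 := by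
    intro z hz
    have hev : R 0 =ᶠ[𝓝 z] fun z' => a + b * z' := by
      filter_upwards [(isOpen_lt continuous_abs continuous_const).mem_nhds ((hwin z hz).1 : z ∈ {z' : ℝ | |z'| < δ})]
        with z' hz' using hab z' hz'
    have hev1 : deriv (R 0) =ᶠ[𝓝 z] fun _ => b := by
      filter_upwards [hev.eventuallyEq_nhds] with z' hz'
      have hd : HasDerivAt (fun z'' : ℝ => a + b * z'') b z' := by
        simpa using ((hasDerivAt_id z').const_mul b).const_add a
      rw [hz'.deriv_eq, hd.deriv]
    rw [hev1.deriv_eq, deriv_const]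
  have hQ0 : ∀ z ∈ Ioo (-δ₁) δ₁, deriv d z ^ 2 + μ (-1) z = 0 := by
    intro z hz
    have h := hHuy z hz
    rw [hR'' z hz] at h
    have h2 : κf z * (deriv d z ^ 2 + μ (-1) z) = 0 := by linear_combination h
    rcases mul_eq_zero.1 h2 with h3 | h3
    · exact absurd h3 (hκf z hz).ne'
    · exact h3
  have hd0 : deriv d 0 = 0 := by
    have h := hQ0 0 h0mem
    rw [hμ00, add_zero] at h
    exact pow_eq_zero_iff (two_ne_zero) |>.1 h
  /- STEP 2: the transport law along the web at `s = 0`. -/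
  have hUan : AnalyticOnNhd ℝ (U (-1)) univ := analyticOnNhd_slice hUcont (bdd_of_hasTypeITimeDecay hUrate) hUmild hm1
  have hU2 : ContDiff ℝ 2 (U (-1)) := hUan.contDiff
  have hθan : AnalyticOnNhd ℝ (fun y => U (-1) y 2) univ := fun x _ =>
    ((EuclideanSpace.proj (𝕜 := ℝ) (2 : Fin 3)).analyticAt _).comp (hUan x (mem_univ _))
  have hθ : ContDiff ℝ ∞ (fun y => U (-1) y 2) := hθan.contDiff
  have hμfun : μ (-1) = uncurry μ ∘ fun z : ℝ => ((-1 : ℝ), z) := by funext z; rfl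
  have hμd : ∀ z ∈ Ioo (-δ₁) δ₁, DifferentiableAt ℝ (μ (-1)) z := fun z _ => by
    rw [hμfun]; exact ((hμ3.differentiable (by norm_num)) _).comp z ((differentiableAt_const _).prodMk differentiableAt_id)
  have hdI : ContDiffOn ℝ ∞ d (Ioo (-δ₁) δ₁) := fun z hz => ((hdω z (hwin z hz).1).of_le le_top).contDiffWithinAt
  have hplane : ∀ z : ℝ, |z| < ρ → ∀ y : EuclideanSpace ℝ (Fin 3), y 2 = z → ∀ b : Fin 3, b ≠ 2 →
      fderiv ℝ (U (-1)) y (EuclideanSpace.single 2 (1 : ℝ)) b = μ (-1) z * fderiv ℝ (U (-1)) y (EuclideanSpace.single b (1 : ℝ)) 2 := by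
    intro z hz y hy b hb
    have h := hslabU (-1) (by simp [hρ]) y (by rw [hy]; exact hz) b hb
    rw [hy] at h; exact h
  have hlawI : ∀ x : EuclideanSpace ℝ (Fin 3), x 2 ∈ Ioo (-δ₁) δ₁ →
      fderiv ℝ (fun y => fderiv ℝ (fun y' => U (-1) y' 2) y (EuclideanSpace.single 2 (1 : ℝ))) x (EuclideanSpace.single 2 (1 : ℝ)) =
        -μ (-1) (x 2) * (fderiv ℝ (fun y => fderiv ℝ (fun y' => U (-1) y' 2) y (EuclideanSpace.single 0 (1 : ℝ))) x
            (EuclideanSpace.single 0 (1 : ℝ)) +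
          fderiv ℝ (fun y => fderiv ℝ (fun y' => U (-1) y' 2) y (EuclideanSpace.single 1 (1 : ℝ))) x
            (EuclideanSpace.single 1 (1 : ℝ))) := fun x hx =>
    plane_wave_identity hU2 (fun y => div_coord (hUdiv (-1) hm1) y) (hplane (x 2) (hwin _ hx).2) rfl
  have hwebI : ∀ s : ℝ, ∀ z ∈ Ioo (-δ₁) δ₁, fderiv ℝ (fun y => U (-1) y 2) (s • e + d z • Jvec e + z • e2) (Jvec e) = 0 :=
    fun s z hz => hcrit s z hz (Jvec e) (by simp [Jvec])
  have htr : ∀ z ∈ Ioo (-δ₁) δ₁, HasDerivAt (fun z' : ℝ => deriv d z' *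
      (fderiv ℝ (fderiv ℝ (fun y => U (-1) y 2)) ((0 : ℝ) • e + d z' • Jvec e + z' • e2) (Jvec e) (Jvec e)) ^ 2) 0 z :=
    fun z hz => transport_on_characteristic_sheet hθ isOpen_Ioo hμd hdI he2 hunit hlawI hwebI hQ0 0 hz
  /- STEP 3: `d′·(∂_ν²U₂)² ≡ 0`, so `d′ ≡ 0` and `μ(−1,·) ≡ 0` on the window. -/
  have hconst : ∀ z ∈ Ioo (-δ₁) δ₁, deriv d z *
      (fderiv ℝ (fderiv ℝ (fun y => U (-1) y 2)) ((0 : ℝ) • e + d z • Jvec e + z • e2) (Jvec e) (Jvec e)) ^ 2 = 0 := by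
    intro z hz
    have h := isOpen_Ioo.is_const_of_deriv_eq_zero isPreconnected_Ioo (fun w hw => (htr w hw).differentiableAt.differentiableWithinAt)
      (fun w hw => (htr w hw).deriv) hz h0mem
    rw [h, hd0, zero_mul]
  have hμ0 : ∀ z ∈ Ioo (-δ₁) δ₁, μ (-1) z = 0 := by
    intro z hz
    have hc := hconcW 0 z hz
    have hT : fderiv ℝ (fderiv ℝ (fun y => U (-1) y 2)) ((0 : ℝ) • e + d z • Jvec e + z • e2) (Jvec e) (Jvec e) ≠ 0 := by
      intro h0; rw [h0, mul_zero] at hc; exact lt_irrefl _ hc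
    have hd' : deriv d z = 0 := by
      rcases mul_eq_zero.1 (hconst z hz) with h | h
      · exact h
      · exact absurd (pow_eq_zero_iff (two_ne_zero) |>.1 h) hT
    have h := hQ0 z hz
    rw [hd', zero_pow two_ne_zero, zero_add] at h
    exact h
  /- STEP 4: no vertical shear on the open slab ⇒ `U ≡ 0`. -/
  have hO : IsOpen {x : EuclideanSpace ℝ (Fin 3) | x 2 ∈ Ioo (-δ₁) δ₁} :=
    isOpen_Ioo.preimage (EuclideanSpace.proj (𝕜 := ℝ) (2 : Fin 3)).continuous
  have hOne : ({x : EuclideanSpace ℝ (Fin 3) | x 2 ∈ Ioo (-δ₁) δ₁}).Nonempty := ⟨0, by simpa using h0mem⟩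
  have hshear : ∀ y ∈ {x : EuclideanSpace ℝ (Fin 3) | x 2 ∈ Ioo (-δ₁) δ₁},
      fderiv ℝ (U (-1)) y (EuclideanSpace.single 2 1) 0 = 0 ∧ fderiv ℝ (U (-1)) y (EuclideanSpace.single 2 1) 1 = 0 := by
    intro y hy
    have h := fun b : Fin 3 => fun hb : b ≠ 2 => hslabU (-1) (by simp [hρ]) y (hwin _ hy).2 b hb
    refine ⟨?_, ?_⟩
    · rw [h 0 (by decide), hμ0 _ hy, zero_mul]
    · rw [h 1 (by decide), hμ0 _ hy, zero_mul]
  have hzero := eq_zero_of_verticalShear_eq_zero_on_open hUrate hUcont hUmild hUdiv hm1 hO hOne hshear (-1) hm1 0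
  exact hUne (by rw [hzero]; rfl)

end Summit.NavierStokesRegularity.NavierStokesRegularity.Theorems.PoloidalWindowDoorLrcModEntireQ4SonicLineFlat

end
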